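import Literature.NumberTheory.IwasawaTheory.Greenberg2016.SelmerAlmostDivisibleCaseCOfFacts
import Literature.NumberTheory.IwasawaTheory.Greenberg2016.GlobalH1AlmostDivisibleOfHTwoVanishing
import HarnessLib

/-!
# Greenberg 2016 Prop. 4.1.1 (c) at a TOTALLY COMPLEX base field when `H²(K_Σ/K, 𝐃) = 0`:
# the conclusion "`S_𝓛(K, 𝐃)` is almost divisible" from [Gr5] Prop. 3.2.1 (c) ALONE — the three
# [Gr4] inputs (Prop. 5.2, Prop. 6.3, Thm. 1 (i)) and LOC⁽²⁾ are NOT needed (theorems only)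

Topic `NumberTheory/IwasawaTheory/Greenberg2016`; namespace
`Literature.NumberTheory.IwasawaTheory.Greenberg2016`; THEOREMS ONLY (no definition, no named fact,
no `sorry`, no instance). Seat `cruxlead-stmt-BirchSwinnertonDyer-20395` g7 (prover LEAD, cell
`pub/bsd-wall`, crux `AdditiveSplitIMCInclusionAtThree`, line `thin_comb`, stub `stub_noPseudoNull`;
`--supports stmt-BirchSwinnertonDyer-20395`).

PRINT. R. Greenberg, *On the structure of Selmer groups*, Springer PROMS 188 (2016), Prop. 4.1.1
(p. 15 L21–32) and its proof (p. 15 L33 – p. 16 L23), with two deep inputs: (α) "`H¹(K_Σ/K, 𝐃)` is an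
almost divisible `Λ`-module … proposition 2.6.1" (p. 15 L33–35; in the tree GRANTED the three [Gr4]
named facts `Greenberg2006.prop52_localH2_torsionBy_injective`, `prop63_shaAway_smul_surjective`,
`thm1_sha2_isCoreflexive`), and (γ) "`φ_Π` is surjective for almost all `Π`" (p. 16 L17–21; in the
tree from [Gr5] Prop. 3.2.1 (c) at its printed generality, the inline hypothesis `h321` of
`SelmerAlmostDivisibleCaseCOfFacts.lean`). The companion file
`GlobalH1AlmostDivisibleOfHTwoVanishing.lean` proves (α) and T5 ("`Ш²(K, Σ, 𝐃[π]) = 0` for almost all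
`Π`", p. 16 L9–13) WITHOUT the [Gr4] facts whenever `K` is totally complex and `H²(K_Σ/K, 𝐃) = 0`
(Greenberg 2006 Prop. 6.10 run with `Σ' = ∅`, `cd_p ≤ 2` a tree theorem). This file re-assembles
Prop. 4.1.1 (c) on that basis:

* §5 `exists_finite_forall_sur_torsionBy_caseC_of_prop321_of_sha2_eq_bot` (and the any-`m` primed
  form) — (γ') in case (c) from `h321`, (α), `Ш² = 0` (the tree's
  `exists_finite_forall_sur_torsionBy_caseC_of_prop321` with T5 so supplied; proof otherwise verbatim);
* §6 **`selmer_isAlmostDivisible_caseC_of_prop321_of_subsingleton_H_two'`** /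
  `selmer_noPseudoNull_caseC_of_prop321_of_subsingleton_H_two'` /
  `selmer_isAlmostDivisible_caseC_of_prop321_of_isCotorsion_H_two'` — Prop. 4.1.1 (c)'s CONCLUSION at
  totally complex `K` with `H²(K_Σ/K, 𝐃) = 0` (resp. cotorsion), from `h321` ALONE (binders = those of
  `selmer_isAlmostDivisible_caseC_of_facts'` minus `h52 h63 hT1 hLEO hLOC2`, plus `[IsTotallyComplex K]`
  and `Subsingleton (ρ.H 2)` / `IsCotorsion Λ (ρ.H 2)`).

At totally complex `K`, `h321` is the END statement of the cell `bsd-eis` road «SUR-Λ»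
(`Summits/…/EisensteinPrimesSurLambdaCaseCTC.lean`, `SurLambda.sur_of_crk_caseC_tc_of_dualSha_torsion` +
`Greenberg2016.dualSha_torsion_of_poitouTateAt`) modulo the ONE textbook fact
`GaloisCohomology.poitouTate_shaRestricted_tateDual_natural_at` (Milne ADT I Thm. 4.10 (a) at finite `S`):
so for such instances `prop411_selmer_isAlmostDivisible` (case (c), `R`-cofree `𝐃`) leaves the debt list.

HONESTY. Conditional on `h321` (a printed theorem, [Gr5] Prop. 3.2.1 (c), typed inline exactly as in
`SelmerAlmostDivisibleCaseCOfFacts.lean`); proves no summit statement; BSD is not advanced by this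
file. AI formalisation, weaker than expert review; the statements are established only by the kernel
check.

## References
* R. Greenberg, *On the structure of Selmer groups*, Springer PROMS 188 (2016) 225–252 — Prop. 4.1.1
  (p. 15 L21–32), proof pp. 15–16, §2.4 p. 8, §3.4 pp. 14–15. [Greenberg2016Selmer]
* R. Greenberg, *On the structure of certain Galois cohomology groups*, Doc. Math. Extra Vol. Coates
  (2006) 335–391 — Prop. 6.1 (p. 381), Prop. 6.10 (p. 385). [Greenberg2006]
* R. Greenberg, *Surjectivity of the global-to-local map defining a Selmer group*, Kyoto J. Math.
  50 (2010) 853–888 — Prop. 3.2.1 (c) (p. 15), §2 p. 6 L1–8. [Greenberg2010]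
-/

noncomputable section

open scoped Classical
open NumberField IsDedekindDomain Field IsLocalRing
open Literature.NumberTheory.GaloisRepresentations
open Literature.NumberTheory.IwasawaTheory.Greenberg2006
open Literature.RingTheory.MvPowerSeries

namespace Literature.NumberTheory.IwasawaTheory.Greenberg2016

/-! ### §5. (γ') in case (c) from `h321`, (α) and `Ш²(K, Σ, 𝐃) = 0` -/

section Gamma

variable {p : ℕ} [Fact p.Prime] {K : Type} [Field K] [NumberField K]
  (S : Set (HeightOneSpectrum (𝓞 K)))
  {Λ : Type} [CommRing Λ] [TopologicalSpace Λ] [IsTopologicalRing Λ]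
  {D : Type} [AddCommGroup D] [Module Λ D] [TopologicalSpace D] [DiscreteTopology D]
  [ContinuousSMul Λ D] (ρ : ContinuousRep (GaloisGroupUnramifiedOutside K S) Λ D)

/-- **(γ') in case (c) of Prop. 4.1.1 from [Gr5] Prop. 3.2.1 (c) (`h321`, printed generality), (α)
and `Ш²(K, Σ, 𝐃) = 0`** — the tree's `exists_finite_forall_sur_torsionBy_caseC_of_prop321` with its
three [Gr4] named facts REPLACED by the two intermediate statements they were used to produce
((α) = "`H¹(K_Σ/K, 𝐃)` almost divisible" and `Ш²(K, Σ, 𝐃) = 0`, whence LEO(𝐃) by `leo_of_sha2_eq_bot`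
and T5 by `exists_finite_sha2_torsionBy_eq_bot_of_sha2_eq_bot`); LOC⁽²⁾ is no longer needed. For
`Λ ≃ ℤ_p⟦T₁,…,T_{m+1}⟧`, `𝐃` discrete `p`-primary cofree over `R ⊇ Λ`, RFX, `𝓛` almost divisible, CRK,
and the case-(c) data at a finite `η ∈ Σ`: there is a finite set of primes of height `≤ 1` off which
SUR(`𝐃[π]`, `𝓛_Π`) holds for every prime `π`. Proof verbatim from the tree's, step for step ("At
each step we exclude finitely many `Π`'s", p. 16 L7–8).
[cite: Greenberg2016Selmer, proof of Prop. 4.1.1, p. 16 L1–37; §2.4 p. 8; §3.4 pp. 14–15]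
[cite: Greenberg2010, Prop. 3.2.1 (p. 15), §2 p. 6 L1–8] -/
theorem exists_finite_forall_sur_torsionBy_caseC_of_prop321_of_sha2_eq_bot
    (h321 : ∀ (P : Type) [CommRing P] [IsLocalRing P] [TopologicalSpace P] [IsTopologicalRing P]
        (m' : ℕ), Nonempty (P ≃+* MvPowerSeries (Fin m') ℤ_[p]) →
      ∀ (D' : Type) [AddCommGroup D'] [Module P D'] [TopologicalSpace D'] [DiscreteTopology D']
        [ContinuousSMul P D'] (ρ' : ContinuousRep (GaloisGroupUnramifiedOutside K S) P D'),
        IsCofinitelyGenerated P D' → (∀ d : D', ∃ n : ℕ, (p ^ n : ℤ) • d = 0) →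
      ∀ (L' : Specification S ρ'), IsDivisible P D' → LEO S ρ' → L'.CRK →
        (∃ η ∈ S, LOC1 S ρ' (Sum.inr η) ∧ IsDivisible P (L'.Q (Sum.inr η))) → L'.SUR)
    (hS : S.Finite) (hSp : ∀ v : HeightOneSpectrum (𝓞 K), ((p : ℕ) : 𝓞 K) ∈ v.asIdeal → v ∈ S)
    [IsLocalRing Λ] {m₀ : ℕ} (e : Λ ≃+* MvPowerSeries (Fin (m₀ + 1)) ℤ_[p])
    {R : Type} [CommRing R] [Algebra Λ R] (hfin : Module.Finite Λ R)
    [Module R D] [IsScalarTower Λ R D] [SMulCommClass R Λ D]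
    (hT : IsCofree R D) (hpD : ∀ d : D, ∃ n : ℕ, (p ^ n : ℤ) • d = 0)
    (L : Specification S ρ) (hRFX : RFX Λ D)
    (hH1 : IsAlmostDivisible Λ (ρ.H 1)) (hsha : sha2 S ρ = ⊥)
    {η : HeightOneSpectrum (𝓞 K)} (hη : η ∈ S) (hLOC1 : LOC1 S ρ (Sum.inr η))
    (hL : L.IsAlmostDivisible) (hCRK : L.CRK) (hQ : IsCoreflexive Λ (L.Q (Sum.inr η))) :
    ∃ F : Set (PrimeSpectrum Λ), F.Finite ∧ (∀ P ∈ F, P.asIdeal.height ≤ 1) ∧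
      ∀ π : Λ, Prime π → (∀ P ∈ F, π ∉ P.asIdeal) → Specification.SUR (S := S)
        (ρ := ρ.subrepresentation (Submodule.torsionBy Λ D π) (ρ.torsionBy_smul_le_comap π))
        (fun v ↦ (L v).comap (Hmap
          (localRep S (ρ.subrepresentation (Submodule.torsionBy Λ D π) (ρ.torsionBy_smul_le_comap π)) v)
          (localRep S ρ v) (Submodule.torsionBy Λ D π).subtypeL (fun _ _ ↦ rfl) 1)) := by
  -- `Λ` is a Noetherian factorial domain
  haveI : IsNoetherianRing Λ := isNoetherianRing_of_ringEquiv_mvPowerSeries e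
  haveI hreg : IsRegularLocalRing (MvPowerSeries (Fin (m₀ + 1)) ℤ_[p]) :=
    NearlyOrdinaryPresentationCA.isRegularLocalRing_mvPowerSeries_dvr ℤ_[p] (m₀ + 1)
  haveI : IsDomain (MvPowerSeries (Fin (m₀ + 1)) ℤ_[p]) :=
    Literature.AlgebraicGeometry.Resolution.isDomain_of_isRegularLocalRing _
  haveI : IsDomain Λ := MulEquiv.isDomain (MvPowerSeries (Fin (m₀ + 1)) ℤ_[p]) e.toMulEquiv
  haveI : UniqueFactorizationMonoid Λ :=
    MulEquiv.uniqueFactorizationMonoid e.symm.toMulEquiv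
      (Literature.AlgebraicGeometry.Resolution.IsRegularLocalRing.uniqueFactorizationMonoid _)
  have hcorefl : IsCoreflexive Λ D := hRFX
  -- LEO(𝐃) from `Ш²(K, Σ, 𝐃) = 0`
  have hLEO : LEO S ρ := leo_of_sha2_eq_bot S ρ hsha
  -- `𝐃` is cofinitely generated over `Λ` (cofree over `R`, `R` finite over `Λ`)
  haveI : IsScalarTower Λ R (CharacterModule D) := ⟨fun a r c ↦ by
    ext d
    simp only [CharacterModule.smul_apply, smul_assoc, smul_comm r a d]⟩
  haveI : Module.Finite Λ R := hfin
  haveI : Module.Finite R (CharacterModule D) :=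
    (hT _ (AddMonoidHom.id (CharacterModule D)) (isDualPairing_characterModule R D)).2
  have hDcg : IsCofinitelyGenerated Λ D :=
    isCofinitelyGenerated_iff_module_finite_characterModule.2 (Module.Finite.trans R _)
  -- a prime element generates a prime ideal of height `≤ 1`
  have hspan : ∀ π : Λ, Prime π → (Ideal.span {π}).IsPrime ∧ (Ideal.span {π}).height ≤ 1 :=
    fun π hπ ↦ ⟨(Ideal.span_singleton_prime hπ.ne_zero).2 hπ,
      Ideal.height_span_singleton_le_one hπ.not_unit⟩
  -- SUR(𝐃, 𝓛) itself from Prop. 3.2.1 (c), and the element `θ` of §3.4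
  have hSUR : L.SUR := h321 Λ (m₀ + 1) ⟨e⟩ D ρ hDcg hpD L hcorefl.isDivisible hLEO hCRK
    ⟨η, hη, hLOC1, hQ.isDivisible⟩
  have hfgS : IsCofinitelyGenerated Λ L.selmer :=
    (isCofinitelyGenerated_H_one S ρ e hDcg hS).submodule L.selmer
  obtain ⟨θ, hθ0, hθ⟩ := exists_ne_zero_forall_phi_torsionBy S ρ L hSUR hfgS hcorefl.isDivisible
  -- the exceptional sets
  obtain ⟨F₅, hF₅, hF₅1, h5⟩ :=
    exists_finite_sha2_torsionBy_eq_bot_of_sha2_eq_bot S ρ hS e hDcg hRFX hH1 hsha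
  obtain ⟨F₇, hF₇, hF₇1, h7⟩ := exists_finite_forall_loc1_torsionBy S ρ hS hSp e hpD hDcg hRFX hLOC1
  have hfgL : IsCofinitelyGenerated Λ (L (Sum.inr η)) :=
    (isCofinitelyGenerated_localRep_H S ρ e hDcg (Sum.inr η) 1).submodule _
  obtain ⟨F₈, hF₈, hF₈1, h8⟩ :=
    (hL (Sum.inr η) ((inSigma_inr_iff S η).2 hη)).exists_finite_forall_smul_surjective hfgL
  have hJθ : Ideal.span {θ} ≠ ⊥ := by rwa [Ne, Ideal.span_singleton_eq_bot]
  let Fθ : Set (PrimeSpectrum Λ) := {P | P.asIdeal.height ≤ 1 ∧ Ideal.span {θ} ≤ P.asIdeal}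
  have hFθ : Fθ.Finite := finite_setOf_height_le_one_and_le hJθ
  -- a prime of height `≤ 1` over `p`
  have hpu : ¬ IsUnit (p : Λ) := by
    intro hu
    have hu' : IsUnit ((p : ℕ) : MvPowerSeries (Fin (m₀ + 1)) ℤ_[p]) := by
      simpa using hu.map e
    rw [MvPowerSeries.isUnit_iff_constantCoeff, map_natCast] at hu'
    exact (PadicInt.irreducible_p (p := p)).not_isUnit hu'
  obtain ⟨Pp, hPp⟩ := (Ideal.span {(p : Λ)}).nonempty_minimalPrimes
    (Ideal.span_singleton_ne_top hpu)
  haveI hPpprime : Pp.IsPrime := hPp.1.1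
  have hPp1 : Pp.height ≤ 1 :=
    Ideal.height_le_one_of_isPrincipal_of_mem_minimalPrimes (Ideal.span {(p : Λ)}) Pp hPp
  -- the finite exceptional set
  refine ⟨F₅ ∪ F₇ ∪ F₈ ∪ Fθ ∪ {⟨Pp, hPpprime⟩}, ((((hF₅.union hF₇).union hF₈).union hFθ).union
    (Set.finite_singleton _)), ?_, ?_⟩
  · rintro P ((((hP | hP) | hP) | hP) | hP)
    · exact hF₅1 P hP
    · exact hF₇1 P hP
    · exact hF₈1 P hP
    · exact hP.1
    · rw [Set.mem_singleton_iff] at hP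
      subst hP
      exact hPp1
  · intro π hπ hπF
    have hF5 : ∀ P ∈ F₅, π ∉ P.asIdeal := fun P hP ↦ hπF P (by simp [hP])
    have hF7 : ∀ P ∈ F₇, π ∉ P.asIdeal := fun P hP ↦ hπF P (by simp [hP])
    have hF8 : ∀ P ∈ F₈, π ∉ P.asIdeal := fun P hP ↦ hπF P (by simp [hP])
    -- `θ ∉ (π)`
    have hθπ : θ ∉ Ideal.span {π} := by
      intro hmem
      have hle : Ideal.span {θ} ≤ Ideal.span {π} := (Ideal.span_singleton_le_iff_mem _).2 hmem
      exact hπF ⟨Ideal.span {π}, (hspan π hπ).1⟩ (by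
        simp only [Set.mem_union, Set.mem_singleton_iff]
        exact Or.inl (Or.inr ⟨(hspan π hπ).2, hle⟩)) (Ideal.mem_span_singleton_self π)
    -- `p ∤ π`
    have hpπ : ¬ (p : Λ) ∣ π := by
      intro hdvd
      have hmem : π ∈ Pp := hPp.1.2 (Ideal.mem_span_singleton.2 hdvd)
      exact hπF ⟨Pp, hPpprime⟩ (by simp) hmem
    -- the `Λ_Π`-device
    obtain ⟨ψ, hψinj, hψfin⟩ := exists_ringHom_quotient_injective_finite_padic e π hπ.not_unit hpπ
    -- the local condition at `η` is `π`-divisible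
    have hLdiv : ∀ x ∈ L (Sum.inr η), ∃ y ∈ L (Sum.inr η), π • y = x := by
      intro x hx
      obtain ⟨y, hy⟩ := h8 π hF8 ⟨x, hx⟩
      exact ⟨y, y.2, congrArg Subtype.val hy⟩
    exact sur_torsionBy_of_prop321_at S ρ h321 hS e hpD hDcg hRFX L hη hQ hπ ψ hψinj hψfin
      (h5 π hF5).1 (h7 π hF7) hLdiv hθπ (hθ π hπ.ne_zero)

omit [TopologicalSpace Λ] [IsTopologicalRing Λ] in
/-- For `Λ ≃ ℤ_p` (no variables) every non-unit is divisible by `p`, so "almost all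
`Π ∈ Spec_{ht=1}(Λ)`" statements are vacuous there. [folklore] -/
private theorem natCast_dvd_of_ringEquiv_fin_zero' (e : Λ ≃+* MvPowerSeries (Fin 0) ℤ_[p]) {π : Λ}
    (hπ : ¬ IsUnit π) : (p : Λ) ∣ π := by
  obtain ⟨a, ha⟩ := MvPowerSeries.C_surjective (σ := Fin 0) (R := ℤ_[p]) (e π)
  have hau : ¬ IsUnit a := fun hu ↦ hπ (by
    have h1 : IsUnit (e π) := by rw [← ha]; exact hu.map _
    simpa using h1.map e.symm)
  have hdvd : (p : ℤ_[p]) ∣ a :=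
    (PadicInt.norm_lt_one_iff_dvd a).1 (PadicInt.mem_nonunits.1 (mem_nonunits_iff.2 hau))
  have h1 : (p : MvPowerSeries (Fin 0) ℤ_[p]) ∣ e π := by
    rw [← ha, ← map_natCast (MvPowerSeries.C (σ := Fin 0) (R := ℤ_[p])) p]
    exact map_dvd _ hdvd
  simpa using map_dvd e.symm h1

/-- **(γ') in case (c), any number of variables** (`Λ ≃ ℤ_p⟦T₁,…,T_m⟧`, `m ≥ 0`; for `m = 0` the
exceptional set is a prime over `p` and the statement is vacuous), from `h321`, (α) and `Ш² = 0`.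
[cite: Greenberg2016Selmer, proof of Prop. 4.1.1, p. 16 L1–37] [cite: Greenberg2010, Prop. 3.2.1 (p. 15)] -/
theorem exists_finite_forall_sur_torsionBy_caseC_of_prop321_of_sha2_eq_bot'
    (h321 : ∀ (P : Type) [CommRing P] [IsLocalRing P] [TopologicalSpace P] [IsTopologicalRing P]
        (m' : ℕ), Nonempty (P ≃+* MvPowerSeries (Fin m') ℤ_[p]) →
      ∀ (D' : Type) [AddCommGroup D'] [Module P D'] [TopologicalSpace D'] [DiscreteTopology D']
        [ContinuousSMul P D'] (ρ' : ContinuousRep (GaloisGroupUnramifiedOutside K S) P D'),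
        IsCofinitelyGenerated P D' → (∀ d : D', ∃ n : ℕ, (p ^ n : ℤ) • d = 0) →
      ∀ (L' : Specification S ρ'), IsDivisible P D' → LEO S ρ' → L'.CRK →
        (∃ η ∈ S, LOC1 S ρ' (Sum.inr η) ∧ IsDivisible P (L'.Q (Sum.inr η))) → L'.SUR)
    (hS : S.Finite) (hSp : ∀ v : HeightOneSpectrum (𝓞 K), ((p : ℕ) : 𝓞 K) ∈ v.asIdeal → v ∈ S)
    [IsLocalRing Λ] {m : ℕ} (e : Λ ≃+* MvPowerSeries (Fin m) ℤ_[p])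
    {R : Type} [CommRing R] [Algebra Λ R] (hfin : Module.Finite Λ R)
    [Module R D] [IsScalarTower Λ R D] [SMulCommClass R Λ D]
    (hT : IsCofree R D) (hpD : ∀ d : D, ∃ n : ℕ, (p ^ n : ℤ) • d = 0)
    (L : Specification S ρ) (hRFX : RFX Λ D)
    (hH1 : IsAlmostDivisible Λ (ρ.H 1)) (hsha : sha2 S ρ = ⊥)
    {η : HeightOneSpectrum (𝓞 K)} (hη : η ∈ S) (hLOC1 : LOC1 S ρ (Sum.inr η))
    (hL : L.IsAlmostDivisible) (hCRK : L.CRK) (hQ : IsCoreflexive Λ (L.Q (Sum.inr η))) :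
    ∃ F : Set (PrimeSpectrum Λ), F.Finite ∧ (∀ P ∈ F, P.asIdeal.height ≤ 1) ∧
      ∀ π : Λ, Prime π → (∀ P ∈ F, π ∉ P.asIdeal) → Specification.SUR (S := S)
        (ρ := ρ.subrepresentation (Submodule.torsionBy Λ D π) (ρ.torsionBy_smul_le_comap π))
        (fun v ↦ (L v).comap (Hmap
          (localRep S (ρ.subrepresentation (Submodule.torsionBy Λ D π) (ρ.torsionBy_smul_le_comap π)) v)
          (localRep S ρ v) (Submodule.torsionBy Λ D π).subtypeL (fun _ _ ↦ rfl) 1)) := by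
  cases m with
  | zero =>
    haveI : IsNoetherianRing Λ := isNoetherianRing_of_ringEquiv_mvPowerSeries e
    have hpu : ¬ IsUnit (p : Λ) := by
      intro hu
      have hu' : IsUnit ((p : ℕ) : MvPowerSeries (Fin 0) ℤ_[p]) := by simpa using hu.map e
      rw [MvPowerSeries.isUnit_iff_constantCoeff, map_natCast] at hu'
      exact (PadicInt.irreducible_p (p := p)).not_isUnit hu'
    obtain ⟨Pp, hPp⟩ := (Ideal.span {(p : Λ)}).nonempty_minimalPrimes
      (Ideal.span_singleton_ne_top hpu)
    haveI hPpprime : Pp.IsPrime := hPp.1.1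
    refine ⟨{⟨Pp, hPpprime⟩}, Set.finite_singleton _, ?_, ?_⟩
    · intro P hP
      rw [Set.mem_singleton_iff] at hP
      subst hP
      exact Ideal.height_le_one_of_isPrincipal_of_mem_minimalPrimes (Ideal.span {(p : Λ)}) Pp hPp
    · intro π hπ hπF
      exact (hπF ⟨Pp, hPpprime⟩ (Set.mem_singleton _) (hPp.1.2 (Ideal.mem_span_singleton.2
        (natCast_dvd_of_ringEquiv_fin_zero' e hπ.not_unit)))).elim
  | succ m₀ =>
    exact exists_finite_forall_sur_torsionBy_caseC_of_prop321_of_sha2_eq_bot S ρ h321 hS hSp e hfin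
      hT hpD L hRFX hH1 hsha hη hLOC1 hL hCRK hQ

end Gamma

/-! ### §6. Prop. 4.1.1 (c) at a totally complex field with `H²(K_Σ/K, 𝐃) = 0`, from `h321` alone -/

section Assembly

variable {p : ℕ} [Fact p.Prime] {K : Type} [Field K] [NumberField K]
  (S : Set (HeightOneSpectrum (𝓞 K)))
  {Λ : Type} [CommRing Λ] [IsLocalRing Λ] [TopologicalSpace Λ] [IsTopologicalRing Λ]
  {D : Type} [AddCommGroup D] [Module Λ D] [TopologicalSpace D] [DiscreteTopology D]
  [ContinuousSMul Λ D] (ρ : ContinuousRep (GaloisGroupUnramifiedOutside K S) Λ D)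

/-- **Greenberg 2016 Prop. 4.1.1 (c) — CONCLUSION, at a totally complex `K` with `H²(K_Σ/K, 𝐃) = 0`,
GRANTED ONLY [Gr5] Prop. 3.2.1 (c) at its printed generality (`h321`)**: for `Λ ≃ ℤ_p⟦T₁,…,T_m⟧`
(`m ≥ 0`), `𝐃` discrete `p`-primary cofree over `R ⊇ Λ` (finite over `Λ`) with RFX, `𝓛` almost
divisible with CRK, and the case-(c) data at a finite `η ∈ Σ` (LOC_η⁽¹⁾, `Q_𝓛(K_η, 𝐃)` coreflexive),
`S_𝓛(K, 𝐃)` is almost `Λ`-divisible. Compared with the tree's `selmer_isAlmostDivisible_caseC_of_facts'`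
the binders `h52 h63 hT1` (NAMED [Gr4] facts), `hLEO` and `hLOC2` are GONE, replaced by
`[IsTotallyComplex K]` and `[Subsingleton (ρ.H 2)]`: (α) is `isAlmostDivisible_H_one_of_subsingleton_H_two`,
(γ') is `exists_finite_forall_sur_torsionBy_caseC_of_prop321_of_sha2_eq_bot'`, (β) the tree's
`selmer_isAlmostDivisible_of_sur_torsionBy_prime`.
[cite: Greenberg2016Selmer, Prop. 4.1.1 (c) (§4.1 p. 15 L21–32); proof p. 15 L33 – p. 16 L23]
[cite: Greenberg2006, Prop. 6.10 (p. 385), Prop. 6.1 (p. 381)] [cite: Greenberg2010, Prop. 3.2.1 (c) (p. 15)] -/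
theorem selmer_isAlmostDivisible_caseC_of_prop321_of_subsingleton_H_two' [IsTotallyComplex K]
    (h321 : ∀ (P : Type) [CommRing P] [IsLocalRing P] [TopologicalSpace P] [IsTopologicalRing P]
        (m' : ℕ), Nonempty (P ≃+* MvPowerSeries (Fin m') ℤ_[p]) →
      ∀ (D' : Type) [AddCommGroup D'] [Module P D'] [TopologicalSpace D'] [DiscreteTopology D']
        [ContinuousSMul P D'] (ρ' : ContinuousRep (GaloisGroupUnramifiedOutside K S) P D'),
        IsCofinitelyGenerated P D' → (∀ d : D', ∃ n : ℕ, (p ^ n : ℤ) • d = 0) →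
      ∀ (L' : Specification S ρ'), IsDivisible P D' → LEO S ρ' → L'.CRK →
        (∃ η ∈ S, LOC1 S ρ' (Sum.inr η) ∧ IsDivisible P (L'.Q (Sum.inr η))) → L'.SUR)
    (hS : S.Finite) (hSp : ∀ v : HeightOneSpectrum (𝓞 K), ((p : ℕ) : 𝓞 K) ∈ v.asIdeal → v ∈ S)
    {m : ℕ} (hΛ : Nonempty (Λ ≃+* MvPowerSeries (Fin m) ℤ_[p]))
    {R : Type} [CommRing R] [Algebra Λ R] (hfin : Module.Finite Λ R)
    [Module R D] [IsScalarTower Λ R D] [SMulCommClass R Λ D]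
    (hT : IsCofree R D) (hpD : ∀ d : D, ∃ n : ℕ, (p ^ n : ℤ) • d = 0)
    (L : Specification S ρ) (hRFX : RFX Λ D) [Subsingleton (ρ.H 2)]
    {η : HeightOneSpectrum (𝓞 K)} (hη : η ∈ S) (hLOC1 : LOC1 S ρ (Sum.inr η))
    (hL : L.IsAlmostDivisible) (hCRK : L.CRK) (hQ : IsCoreflexive Λ (L.Q (Sum.inr η))) :
    IsAlmostDivisible Λ L.selmer := by
  obtain ⟨e⟩ := hΛ
  -- `Λ` is a Noetherian factorial domain
  haveI : IsNoetherianRing Λ := isNoetherianRing_of_ringEquiv_mvPowerSeries e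
  haveI hreg : IsRegularLocalRing (MvPowerSeries (Fin m) ℤ_[p]) :=
    NearlyOrdinaryPresentationCA.isRegularLocalRing_mvPowerSeries_dvr ℤ_[p] m
  haveI : IsDomain (MvPowerSeries (Fin m) ℤ_[p]) :=
    Literature.AlgebraicGeometry.Resolution.isDomain_of_isRegularLocalRing _
  haveI : IsDomain Λ := MulEquiv.isDomain (MvPowerSeries (Fin m) ℤ_[p]) e.toMulEquiv
  haveI : UniqueFactorizationMonoid Λ :=
    MulEquiv.uniqueFactorizationMonoid e.symm.toMulEquiv
      (Literature.AlgebraicGeometry.Resolution.IsRegularLocalRing.uniqueFactorizationMonoid _)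
  -- `𝐃` is cofinitely generated over `Λ`
  haveI : IsScalarTower Λ R (CharacterModule D) := ⟨fun a r c ↦ by
    ext d
    simp only [CharacterModule.smul_apply, smul_assoc, smul_comm r a d]⟩
  haveI : Module.Finite Λ R := hfin
  haveI : Module.Finite R (CharacterModule D) :=
    (hT _ (AddMonoidHom.id (CharacterModule D)) (isDualPairing_characterModule R D)).2
  have hD : IsCofinitelyGenerated Λ D :=
    isCofinitelyGenerated_iff_module_finite_characterModule.2 (Module.Finite.trans R _)
  -- `Ш²(K, Σ, 𝐃) = 0` and (α)
  have hsha : sha2 S ρ = ⊥ := sha2_eq_bot_of_subsingleton_H_two ρ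
  have hH1 : IsAlmostDivisible Λ (ρ.H 1) :=
    isAlmostDivisible_H_one_of_subsingleton_H_two ρ hSp hpD hRFX
      (isCofinitelyGenerated_H_one S ρ e hD hS)
  -- (β) at primes, fed with (γ')
  exact selmer_isAlmostDivisible_of_sur_torsionBy_prime S ρ hS e hD hRFX L hL hH1
    (exists_finite_forall_sur_torsionBy_caseC_of_prop321_of_sha2_eq_bot' S ρ h321 hS hSp e hfin hT
      hpD L hRFX hH1 hsha hη hLOC1 hL hCRK hQ)

/-- The consumers' reading (shape of `prop411_selmer_isAlmostDivisible.caseC`): at a totally complex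
`K` with `H²(K_Σ/K, 𝐃) = 0`, granted `h321` only, every Pontryagin dual of `S_𝓛(K, 𝐃)` has no
non-zero pseudo-null `Λ`-submodule. [cite: Greenberg2016Selmer, Prop. 4.1.1 (c) (§4.1 p. 15 L21–32)] -/
theorem selmer_noPseudoNull_caseC_of_prop321_of_subsingleton_H_two' [IsTotallyComplex K]
    (h321 : ∀ (P : Type) [CommRing P] [IsLocalRing P] [TopologicalSpace P] [IsTopologicalRing P]
        (m' : ℕ), Nonempty (P ≃+* MvPowerSeries (Fin m') ℤ_[p]) →
      ∀ (D' : Type) [AddCommGroup D'] [Module P D'] [TopologicalSpace D'] [DiscreteTopology D']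
        [ContinuousSMul P D'] (ρ' : ContinuousRep (GaloisGroupUnramifiedOutside K S) P D'),
        IsCofinitelyGenerated P D' → (∀ d : D', ∃ n : ℕ, (p ^ n : ℤ) • d = 0) →
      ∀ (L' : Specification S ρ'), IsDivisible P D' → LEO S ρ' → L'.CRK →
        (∃ η ∈ S, LOC1 S ρ' (Sum.inr η) ∧ IsDivisible P (L'.Q (Sum.inr η))) → L'.SUR)
    (hS : S.Finite) (hSp : ∀ v : HeightOneSpectrum (𝓞 K), ((p : ℕ) : 𝓞 K) ∈ v.asIdeal → v ∈ S)
    {m : ℕ} (hΛ : Nonempty (Λ ≃+* MvPowerSeries (Fin m) ℤ_[p]))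
    {R : Type} [CommRing R] [Algebra Λ R] (hfin : Module.Finite Λ R)
    [Module R D] [IsScalarTower Λ R D] [SMulCommClass R Λ D]
    (hT : IsCofree R D) (hpD : ∀ d : D, ∃ n : ℕ, (p ^ n : ℤ) • d = 0)
    (L : Specification S ρ) (hRFX : RFX Λ D) [Subsingleton (ρ.H 2)]
    {η : HeightOneSpectrum (𝓞 K)} (hη : η ∈ S) (hLOC1 : LOC1 S ρ (Sum.inr η))
    (hL : L.IsAlmostDivisible) (hCRK : L.CRK) (hQ : IsCoreflexive Λ (L.Q (Sum.inr η)))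
    {X : Type} [AddCommGroup X] [Module Λ X] {toDual : X →+ (L.selmer →+ AddCircle (1 : ℚ))}
    (hX : IsDualPairing Λ L.selmer toDual) {N : Submodule Λ X} (hN : Literature.NumberTheory.EllipticCurves.Module.IsPseudoNull Λ N) :
    N = ⊥ :=
  (selmer_isAlmostDivisible_caseC_of_prop321_of_subsingleton_H_two' S ρ h321 hS hSp hΛ hfin hT hpD L
    hRFX hη hLOC1 hL hCRK hQ).eq_bot_of_isPseudoNull hX hN

/-- **The same with `H²(K_Σ/K, 𝐃)` COTORSION in place of zero** (the shape the Euler-characteristic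
squeeze delivers: `corank_Λ H²(K_Σ/K, 𝐃) = 0` with `H²` cofinitely generated): `H² = 0` by
`subsingleton_H_two_of_isCotorsion` (Prop. 6.1 + §1), then the previous theorem.
[cite: Greenberg2016Selmer, Prop. 4.1.1 (c) (§4.1 p. 15 L21–32); §2.3 p. 7 L1–17] [cite: Greenberg2006, Prop. 6.1 (p. 381)] -/
theorem selmer_isAlmostDivisible_caseC_of_prop321_of_isCotorsion_H_two' [IsTotallyComplex K]
    (h321 : ∀ (P : Type) [CommRing P] [IsLocalRing P] [TopologicalSpace P] [IsTopologicalRing P]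
        (m' : ℕ), Nonempty (P ≃+* MvPowerSeries (Fin m') ℤ_[p]) →
      ∀ (D' : Type) [AddCommGroup D'] [Module P D'] [TopologicalSpace D'] [DiscreteTopology D']
        [ContinuousSMul P D'] (ρ' : ContinuousRep (GaloisGroupUnramifiedOutside K S) P D'),
        IsCofinitelyGenerated P D' → (∀ d : D', ∃ n : ℕ, (p ^ n : ℤ) • d = 0) →
      ∀ (L' : Specification S ρ'), IsDivisible P D' → LEO S ρ' → L'.CRK →
        (∃ η ∈ S, LOC1 S ρ' (Sum.inr η) ∧ IsDivisible P (L'.Q (Sum.inr η))) → L'.SUR)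
    (hS : S.Finite) (hSp : ∀ v : HeightOneSpectrum (𝓞 K), ((p : ℕ) : 𝓞 K) ∈ v.asIdeal → v ∈ S)
    {m : ℕ} (hΛ : Nonempty (Λ ≃+* MvPowerSeries (Fin m) ℤ_[p]))
    {R : Type} [CommRing R] [Algebra Λ R] (hfin : Module.Finite Λ R)
    [Module R D] [IsScalarTower Λ R D] [SMulCommClass R Λ D]
    (hT : IsCofree R D) (hpD : ∀ d : D, ∃ n : ℕ, (p ^ n : ℤ) • d = 0)
    (L : Specification S ρ) (hRFX : RFX Λ D) (hH2 : IsCotorsion Λ (ρ.H 2))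
    {η : HeightOneSpectrum (𝓞 K)} (hη : η ∈ S) (hLOC1 : LOC1 S ρ (Sum.inr η))
    (hL : L.IsAlmostDivisible) (hCRK : L.CRK) (hQ : IsCoreflexive Λ (L.Q (Sum.inr η))) :
    IsAlmostDivisible Λ L.selmer := by
  obtain ⟨e⟩ := hΛ
  haveI hreg : IsRegularLocalRing (MvPowerSeries (Fin m) ℤ_[p]) :=
    NearlyOrdinaryPresentationCA.isRegularLocalRing_mvPowerSeries_dvr ℤ_[p] m
  haveI : IsDomain (MvPowerSeries (Fin m) ℤ_[p]) :=
    Literature.AlgebraicGeometry.Resolution.isDomain_of_isRegularLocalRing _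
  haveI : IsDomain Λ := MulEquiv.isDomain (MvPowerSeries (Fin m) ℤ_[p]) e.toMulEquiv
  have hcorefl : IsCoreflexive Λ D := hRFX
  haveI : Subsingleton (ρ.H 2) :=
    subsingleton_H_two_of_isCotorsion ρ hSp hpD hcorefl.isDivisible hH2
  exact selmer_isAlmostDivisible_caseC_of_prop321_of_subsingleton_H_two' S ρ h321 hS hSp ⟨e⟩ hfin hT
    hpD L hRFX hη hLOC1 hL hCRK hQ

end Assembly

end Literature.NumberTheory.IwasawaTheory.Greenberg2016

end
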